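import Summits.ResolutionOfSingularities.ResolutionOfSingularities.Theorems.EquisingularLiftEquisingularLiftNatOccursAsSingularLocusReduced
import Mathlib.RingTheory.IntegralClosure.IntegrallyClosed
import Mathlib.RingTheory.DiscreteValuationRing.Basic
import HarnessLib

/-!
# [OURS · L1 W4.5(b) · EL♮] (V) NO-PURE-NOSE — the algebra SPINE of res-L1-w45b-lead-1's ★ memo (steps (iv), (iii)-end, (7), (7)-fields)
# (crux `EquisingularLiftNat` = stmt-ResolutionOfSingularities-20038; PARENT ≥ 4 band / kill test #50 K5-BMY, PURE column)

HONEST FRAMING. OURS (cell res-hironaka, crux chain w45b, slot W4.5(b)); NOT a statement of any manuscript; replaces the role of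
NOTHING in the manuscript; AI-written, AI review is weaker than expert review. Helper `--supports stmt-ResolutionOfSingularities-20038
--as helper`. Object «(V) NO-PURE-NOSE: ATTACK READ + KERNEL SPINE» named by res-L1-w45b-plan-1 g17 (DESK 2026-08-27T21:18:40Z) for
res-D-brk-4 g9; the attack read CONCURRED (STATUS 21:21:56Z) with res-L1-w45b-lead-1's by-hand memo `L/res-L1-w45b-lead-1/NO-PURE-NOSE.md`
(sha16 447f60b58742ace8): «no NORMAL O-flat X̃ ⊂ P_j has special fibre the avatar with multiplicity one — push down to ℙ⁵_O and normalise: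
a smooth lift of the BMY-violator S». This file kernels the pure-algebra steps of §1 of that memo that the library reaches TODAY, def-free:

* (iv) = memo step (8) «finite birational onto a NORMAL integral scheme is an isomorphism»: `surjective_algebraMap_of_isIntegral_of_injective`,
  `bijective_algebraMap_of_isIntegral_of_injective` — `A ⊆ B ⊆ Frac A`, `B` integral over `A`, `A` integrally closed ⇒ `A = B`
  (Mathlib `IsIntegrallyClosed.isIntegral_iff`).
* (iii)-end = memo step (8) «R₀ + S₁ ⇒ REDUCED»: `isReduced_of_R0_S1` — a Noetherian ring whose associated primes are minimal (S₁) and whose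
  localisations at minimal primes are reduced (R₀, e.g. fields: «generically reduced») is reduced (over the tree's
  `isReduced_of_isReduced_localization_associatedPrimes`, H-L0b (R)).
* memo step (7) «`𝒪_{S̃^ν,𝔭} → 𝒪_{X̃,η_Z̃}` local injective between DVRs, `ord_{η_Z̃} ϖ = 1 ⇒ ord_𝔭 ϖ = 1`»:
  `irreducible_of_irreducible_map_of_isLocalHom` (a LOCAL ring map reflects irreducibility) and `maximalIdeal_eq_span_of_irreducible_map`
  (in a DVR: if the image of `ϖ` under a local hom is irreducible then `ϖ` is a uniformiser, Mathlib `irreducible_iff_uniformizer`).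
* memo step (7) fields «`K(S) = k(η_S) → k(𝔭) → k(η_Z̃) = K(S)` composing to the birational identity ⇒ `k(𝔭) = K(S)`»:
  `bijective_of_comp_bijective_of_injective` (if `g ∘ f` is bijective and `g` injective — automatic for field maps — then `f` and `g` are bijective).

NEED-FACT (what the spine does NOT reach in the tree today; exact signatures for res-L1-type-o6 / res-lit-6, per the desk):
* F-(V)a — NAGATA FINITENESS OF NORMALISATION over a complete DVR (memo step (5); EGA IV 7.8.3 (iii)+(vi), or Nagata: complete local rings are
  Nagata rings and finitely generated algebras over Nagata rings are Nagata [Matsumura 1980, (31.H) Thm. 72, (31.C) Thm. 68 / Stacks 0335, 032W]):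
  `∀ (O A : Type) [CommRing O] [IsDomain O] [IsDiscreteValuationRing O] [IsAdicComplete (IsLocalRing.maximalIdeal O) O] [CommRing A] [IsDomain A]
     [Algebra O A], Algebra.FiniteType O A → Module.Finite A (integralClosure A (FractionRing A))`.
  (The tree has `isExcellentRing_of_isAdicComplete` (complete local ⇒ excellent) and dim-1 / G-ring finiteness (`FiniteNormalizationGRing`,
  `CompleteDVRIntegralClosure`, `CompleteLocalDomainNormalization`), but not Nagata's theorem for finite-type algebras.)
* F-(V)b — S₂ FOR NORMAL DOMAINS, principal-ideal form (memo step (6) «S̃^ν normal ⇒ S₂, ϖ regular ⇒ S̃^ν/ϖ is S₁»; [Matsumura1987, Thm. 11.5 /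
  §17 (S₂)]; Krull: a Noetherian normal domain is the intersection of its height-one localisations, so principal ideals have no embedded primes):
  `∀ (R : Type) [CommRing R] [IsDomain R] [IsNoetherianRing R] [IsIntegrallyClosed R] (a : R), a ≠ 0 →
     ∀ 𝔔 : Ideal R, 𝔔 ∈ associatedPrimes R (R ⧸ Ideal.span {a}) → 𝔔.primeHeight = 1`
  (reachable by the determinant trick `isIntegral_of_smul_mem_submodule` + Krull's principal ideal theorem; not attempted in this file).
The scheme-theoretic steps (1)–(5), (9) (scheme-theoretic image, fibre dimension, «proper + quasi-finite ⇒ finite», smoothness from a smooth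
fibre, constancy of `K²`/`χ`, BMY) stay by hand with their standard facts as listed in the memo's §5.

References: H. Matsumura, *Commutative Ring Theory* (1986), Thms. 11.5, 17.8, §23 (Serre's criteria) [Matsumura1987]; [StacksProject, Tags 031R,
035Q, 0335, 032W, 02OG]; A. Grothendieck, EGA IV 7.8.3; tree `…NatOccursAsSingularLocusReduced` (`isReduced_of_isReduced_localization_associatedPrimes`).
-/

set_option linter.dupNamespace false -- mandated namespace `Summit.<Summit>.<Problem>` of this single-conjunct summit

noncomputable section

universe u

open IsLocalRing

namespace Summit.ResolutionOfSingularities.ResolutionOfSingularities.Cruxes.EquisingularLiftNat.Sections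

namespace NoPureNose

/-! ## (iv) Finite (integral) and birational onto an integrally closed domain ⇒ equal -/

/-- **Memo step (8) / desk step (iv): `A ⊆ B ⊆ Frac A`, `B` integral over `A`, `A` integrally closed ⇒ `A = B`.** Stated for an
`A`-algebra `B` mapping injectively to the fraction field `K` of `A` compatibly (`IsScalarTower A B K`): `algebraMap A B` is surjective.
[cite: Matsumura1987, §9 (integral closure)] -/
theorem surjective_algebraMap_of_isIntegral_of_injective {A B K : Type*} [CommRing A] [CommRing B] [Field K]
    [Algebra A B] [Algebra A K] [Algebra B K] [IsScalarTower A B K] [IsFractionRing A K] [IsIntegrallyClosed A]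
    [Algebra.IsIntegral A B] (hBK : Function.Injective (algebraMap B K)) :
    Function.Surjective (algebraMap A B) := by
  intro b
  have hb : IsIntegral A (algebraMap B K b) := (Algebra.IsIntegral.isIntegral (R := A) b).map (IsScalarTower.toAlgHom A B K)
  obtain ⟨a, ha⟩ := IsIntegrallyClosed.isIntegral_iff.mp hb
  refine ⟨a, hBK ?_⟩
  rw [← ha, IsScalarTower.algebraMap_apply A B K]

/-- The same as a BIJECTION `A ≅ B` (injectivity of `A → B` from that of `A → K`). [cite: Matsumura1987, §9] -/
theorem bijective_algebraMap_of_isIntegral_of_injective {A B K : Type*} [CommRing A] [CommRing B] [Field K]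
    [Algebra A B] [Algebra A K] [Algebra B K] [IsScalarTower A B K] [IsFractionRing A K] [IsIntegrallyClosed A]
    [Algebra.IsIntegral A B] (hBK : Function.Injective (algebraMap B K)) :
    Function.Bijective (algebraMap A B) := by
  refine ⟨fun a₁ a₂ h => ?_, surjective_algebraMap_of_isIntegral_of_injective hBK⟩
  apply IsFractionRing.injective A K
  rw [IsScalarTower.algebraMap_apply A B K, IsScalarTower.algebraMap_apply A B K, h]

/-! ## (iii)-end Serre: `R₀ + S₁ ⇒ reduced` -/

/-- **Memo step (8) / desk step (iii)-end: `R₀ + S₁ ⇒ REDUCED`.** A Noetherian ring whose associated primes are minimal primes (S₁: no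
embedded primes) and whose localisations at its minimal primes are reduced (R₀ in the form «generically reduced»; fields in the memo) is
reduced. [cite: Matsumura1987, §23 (Serre's criterion for reducedness)] -/
theorem isReduced_of_R0_S1 {B : Type u} [CommRing B] [IsNoetherianRing B]
    (hS1 : ∀ (𝔔 : Ideal B) [𝔔.IsPrime], 𝔔 ∈ associatedPrimes B B → 𝔔 ∈ minimalPrimes B)
    (hR0 : ∀ (𝔭 : Ideal B) [𝔭.IsPrime], 𝔭 ∈ minimalPrimes B → IsReduced (Localization.AtPrime 𝔭)) :
    IsReduced B :=
  isReduced_of_isReduced_localization_associatedPrimes (fun 𝔔 _ h𝔔 => hR0 𝔔 (hS1 𝔔 h𝔔))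

/-! ## Step (7): a local homomorphism of DVRs with `ord (f ϖ) = 1` forces `ord ϖ = 1` -/

/-- **A LOCAL ring homomorphism reflects irreducibility**: if `f x` is irreducible then so is `x` (a factorisation of `x` maps to one of
`f x`, one factor of which is then a unit, and `f` reflects units). [folklore] -/
theorem irreducible_of_irreducible_map_of_isLocalHom {A B : Type*} [CommRing A] [CommRing B] (f : A →+* B) [hf : IsLocalHom f]
    {x : A} (hx : Irreducible (f x)) : Irreducible x := by
  refine ⟨fun hu => hx.not_isUnit (hu.map f), fun a b hab => ?_⟩
  have h := hx.isUnit_or_isUnit (show f x = f a * f b by rw [hab, map_mul])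
  exact h.imp (hf.map_nonunit a) (hf.map_nonunit b)

/-- **Memo step (7), DVR form**: for a local homomorphism `f : A → B` out of a DVR, if `f ϖ` is irreducible (e.g. `B` a DVR in which `f ϖ`
has order `1`) then `ϖ` is a uniformiser of `A`: `𝔪_A = (ϖ)`, i.e. `ord_A ϖ = 1`. [cite: Matsumura1987, Thm. 11.1/11.2 (DVRs)] -/
theorem maximalIdeal_eq_span_of_irreducible_map {A B : Type*} [CommRing A] [IsDomain A] [IsDiscreteValuationRing A] [CommRing B]
    (f : A →+* B) [IsLocalHom f] {ϖ : A} (hϖ : Irreducible (f ϖ)) : maximalIdeal A = Ideal.span {ϖ} :=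
  (IsDiscreteValuationRing.irreducible_iff_uniformizer ϖ).mp (irreducible_of_irreducible_map_of_isLocalHom f hϖ)

/-! ## Step (7), residue fields: a sandwich `K → L → K` composing to a bijection -/

/-- **Memo step (7), residue fields**: if `g ∘ f` is bijective and `g` is injective (automatic for ring maps out of a field) then `f` and
`g` are both bijective — applied to `K(S) = k(η_S) → k(𝔭) → k(η_Z̃) = K(S)` composing to the birational identity: `k(𝔭) = K(S)`. [folklore] -/
theorem bijective_of_comp_bijective_of_injective {α β γ : Type*} {f : α → β} {g : β → γ} (hgf : Function.Bijective (g ∘ f))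
    (hg : Function.Injective g) : Function.Bijective f ∧ Function.Bijective g := by
  have hf_surj : Function.Surjective f := fun b => by
    obtain ⟨a, ha⟩ := hgf.2 (g b)
    exact ⟨a, hg ha⟩
  exact ⟨⟨hgf.1.of_comp, hf_surj⟩, ⟨hg, hgf.2.of_comp⟩⟩

/-- The field form: for ring homomorphisms `f : K →+* L`, `g : L →+* M` of fields with `g ∘ f` surjective, `f` is bijective
(`k(𝔭) = K(S)` in the memo). [folklore] -/
theorem bijective_of_comp_surjective_fields {K L M : Type*} [Field K] [Field L] [Field M] (f : K →+* L) (g : L →+* M)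
    (h : Function.Surjective (g.comp f)) : Function.Bijective f :=
  (bijective_of_comp_bijective_of_injective (f := f) (g := g) ⟨(g.comp f).injective, h⟩ g.injective).1

end NoPureNose

end Summit.ResolutionOfSingularities.ResolutionOfSingularities.Cruxes.EquisingularLiftNat.Sections
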